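import Mathlib.Combinatorics.SimpleGraph.Walk.Counting
import Mathlib.Combinatorics.SimpleGraph.Paths
import Mathlib.Combinatorics.SimpleGraph.DeleteEdges
import Mathlib.Combinatorics.SimpleGraph.Connectivity.Subgraph
import Mathlib.Topology.Algebra.InfiniteSum.ENNReal
import Mathlib.Tactic.Ring
import Summits.CriticalPhenomena.SAWScalingLimit.Theorems.SAWTotalPositivityBoundaryTP2Defs
import HarnessLib

/-!
# Crux `BoundaryTP2` (stmt-CriticalPhenomena-7115), line `Sketch`: the first-meeting switching identity

Stub `stub_switchingIdentity` of the line's skeleton: for a simple graph `H`, `x ≥ 0` and an interlaced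
quadruple, `Z₁₂ Z₃₄ + C_bad = Z₁₃ Z₂₄ + D + N_bad` (`Z = pathKernel H x`; `D` = vertex-disjoint nested
pairs; a meeting pair is `bad` when the tails after the first vertex of the first path on the second meet
again), by the Karlin–McGregor / Lindström switch at the first meeting vertex — an involution on
first-meeting data `(v, γ, γ')` preserving total length — written with Mathlib's `Walk.takeUntil` /
`Walk.dropUntil` and `ℝ≥0∞`-valued `tsum`s; no planarity or finiteness is used. [folklore]
-/

noncomputable section

namespace Summit.CriticalPhenomena.SAWScalingLimit.Theorems.BoundaryTP2

open SimpleGraph Walk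
open scoped ENNReal

variable {V : Type*}

/-! ## Walk lemmas: junctions of appended paths -/

/-- Left cancellation for `Walk.append`. [folklore] -/
private theorem append_cancel_left {H : SimpleGraph V} {u v w : V} (p : H.Walk u v)
    (q r : H.Walk v w) (h : p.append q = p.append r) : q = r := by
  induction p with
  | nil => exact h
  | cons hadj p ih =>
    rw [cons_append, cons_append] at h
    simp only [cons.injEq, heq_eq_eq, true_and] at h
    exact ih q r h

open Classical in
/-- For a path `p : u → v`, cutting `p.append q` at the junction `v` returns `p`. [folklore] -/
private theorem takeUntil_append_of_isPath {H : SimpleGraph V} {u v w : V} (p : H.Walk u v)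
    (q : H.Walk v w) (hp : p.IsPath) (h : v ∈ (p.append q).support) :
    (p.append q).takeUntil v h = p := by
  rw [takeUntil_append_of_mem_left p q p.end_mem_support]
  have h1 := p.take_spec p.end_mem_support
  have h2 : p.dropUntil v p.end_mem_support = Walk.nil :=
    eq_nil_iff_nil.2 (isPath_iff_nil.1 (hp.dropUntil _))
  rwa [h2, append_nil] at h1

open Classical in
/-- For a path `p : u → v`, the part of `p.append q` after the junction `v` is `q`. [folklore] -/
private theorem dropUntil_append_of_isPath {H : SimpleGraph V} {u v w : V} (p : H.Walk u v)
    (q : H.Walk v w) (hp : p.IsPath) (h : v ∈ (p.append q).support) :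
    (p.append q).dropUntil v h = q := by
  have h1 := (p.append q).take_spec h
  rw [takeUntil_append_of_isPath p q hp h] at h1
  exact append_cancel_left p _ _ h1

/-- Two paths meeting only at the junction concatenate to a path. [folklore] -/
private theorem isPath_append {H : SimpleGraph V} {u v w : V} {p : H.Walk u v} {q : H.Walk v w}
    (hp : p.IsPath) (hq : q.IsPath) (hpq : ∀ z ∈ p.support, z ∈ q.support → z = v) :
    (p.append q).IsPath := by
  rw [isPath_def] at hp hq ⊢
  rw [support_append]
  rw [← q.cons_tail_support, List.nodup_cons] at hq
  refine List.nodup_append.2 ⟨hp, hq.2, ?_⟩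
  rintro a ha b hb rfl
  have hav : a = v :=
    hpq a ha (by rw [← q.cons_tail_support]; exact List.mem_cons_of_mem _ hb)
  rw [hav] at hb
  exact hq.1 hb

open Classical in
/-- In a path, a vertex lying both weakly before and weakly after `v` is `v`. [folklore] -/
private theorem eq_of_mem_takeUntil_dropUntil {H : SimpleGraph V} {u w v : V} {p : H.Walk u w}
    (hp : p.IsPath) (hv : v ∈ p.support) {z : V} (h₁ : z ∈ (p.takeUntil v hv).support)
    (h₂ : z ∈ (p.dropUntil v hv).support) : z = v := by
  by_contra hne
  rw [← p.take_spec hv] at hp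
  exact hp.ne_of_mem_support_of_append hne h₁ h₂ rfl

/-! ## The first meeting vertex -/

open Classical in
/-- The first vertex of `γ` lying on `γ'` is unique. [folklore] -/
private theorem first_unique {H : SimpleGraph V} {a b c d v₁ v₂ : V} {γ : H.Walk a c}
    {γ' : H.Walk b d} (hv₁ : v₁ ∈ γ.support) (hv₂ : v₂ ∈ γ.support) (h₁ : v₁ ∈ γ'.support)
    (h₂ : v₂ ∈ γ'.support) (hf₁ : ∀ z ∈ (γ.takeUntil v₁ hv₁).support, z ∈ γ'.support → z = v₁)
    (hf₂ : ∀ z ∈ (γ.takeUntil v₂ hv₂).support, z ∈ γ'.support → z = v₂) : v₁ = v₂ := by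
  rcases List.prefix_or_prefix_of_prefix (γ.support_takeUntil_prefix_support hv₁)
      (γ.support_takeUntil_prefix_support hv₂) with h | h
  · exact hf₂ v₁ (h.subset (end_mem_support _)) h₁
  · exact (hf₁ v₂ (h.subset (end_mem_support _)) h₂).symm

open Classical in
/-- If `γ` meets `γ'`, some vertex of `γ` is the first one lying on `γ'`. [folklore] -/
private theorem first_exists {H : SimpleGraph V} {a b c d : V} (γ : H.Walk a c) (γ' : H.Walk b d)
    (h : ¬ List.Disjoint γ.support γ'.support) :
    ∃ (v : V) (hv : v ∈ γ.support), v ∈ γ'.support ∧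
      ∀ z ∈ (γ.takeUntil v hv).support, z ∈ γ'.support → z = v := by
  obtain ⟨v, hvs, hv, hf⟩ :=
    Walk.exists_mem_support_forall_mem_support_imp_eq (p := γ) γ'.support.toFinset (by
      by_contra h'
      refine h fun z hz hz' => h' ⟨z, ?_⟩
      exact Finset.mem_filter.2 ⟨List.mem_toFinset.2 hz', hz⟩)
  exact ⟨v, hv, List.mem_toFinset.1 hvs, fun z hz hz' => hf z (List.mem_toFinset.2 hz') hz⟩

/-! ## The switch at the first meeting vertex -/

open Classical in
/-- **The switch.** For paths `γ : a → c`, `γ' : b → d`, a vertex `v` of `γ` which is the first one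
lying on `γ'`, and tails after `v` meeting only at `v`, the switched walks
`α = γ[a,v] · γ'[b,v]⁻¹ : a → b` and `β = γ[v,c]⁻¹ · γ'[v,d] : c → d` are paths, switching
`(α, β)` at `v` gives back `(γ, γ')`, `v` is again the first vertex of `α` on `β`, the tails of
`α, β` after `v` meet only at `v`, and `|α| + |β| = |γ| + |γ'|`. [folklore] -/
private theorem switch_spec {H : SimpleGraph V} {a b c d v : V} {γ : H.Walk a c} {γ' : H.Walk b d}
    (hγ : γ.IsPath) (hγ' : γ'.IsPath) (hv : v ∈ γ.support) (hv' : v ∈ γ'.support)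
    (hfirst : ∀ z ∈ (γ.takeUntil v hv).support, z ∈ γ'.support → z = v)
    (htail : ∀ z ∈ (γ.dropUntil v hv).support, z ∈ (γ'.dropUntil v hv').support → z = v) :
    ((γ.takeUntil v hv).append (γ'.takeUntil v hv').reverse).IsPath ∧
    ((γ.dropUntil v hv).reverse.append (γ'.dropUntil v hv')).IsPath ∧
    (∀ h₁ h₂, (((γ.takeUntil v hv).append (γ'.takeUntil v hv').reverse).takeUntil v h₁).append
        (((γ.dropUntil v hv).reverse.append (γ'.dropUntil v hv')).takeUntil v h₂).reverse = γ) ∧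
    (∀ h₁ h₂, (((γ.takeUntil v hv).append (γ'.takeUntil v hv').reverse).dropUntil v h₁).reverse.append
        (((γ.dropUntil v hv).reverse.append (γ'.dropUntil v hv')).dropUntil v h₂) = γ') ∧
    (∀ h₁, ∀ z ∈ (((γ.takeUntil v hv).append (γ'.takeUntil v hv').reverse).takeUntil v h₁).support,
        z ∈ ((γ.dropUntil v hv).reverse.append (γ'.dropUntil v hv')).support → z = v) ∧
    (∀ h₁ h₂, ∀ z ∈ (((γ.takeUntil v hv).append (γ'.takeUntil v hv').reverse).dropUntil v h₁).support,
        z ∈ (((γ.dropUntil v hv).reverse.append (γ'.dropUntil v hv')).dropUntil v h₂).support →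
          z = v) ∧
    ((γ.takeUntil v hv).append (γ'.takeUntil v hv').reverse).length
        + ((γ.dropUntil v hv).reverse.append (γ'.dropUntil v hv')).length
      = γ.length + γ'.length := by
  have hp₁ : (γ.takeUntil v hv).IsPath := hγ.takeUntil hv
  have hp₂ : (γ.dropUntil v hv).reverse.IsPath := (hγ.dropUntil hv).reverse
  have e₁ : ∀ h, ((γ.takeUntil v hv).append (γ'.takeUntil v hv').reverse).takeUntil v h
      = γ.takeUntil v hv := fun h => takeUntil_append_of_isPath _ _ hp₁ h
  have e₂ : ∀ h, ((γ.takeUntil v hv).append (γ'.takeUntil v hv').reverse).dropUntil v h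
      = (γ'.takeUntil v hv').reverse := fun h => dropUntil_append_of_isPath _ _ hp₁ h
  have e₃ : ∀ h, ((γ.dropUntil v hv).reverse.append (γ'.dropUntil v hv')).takeUntil v h
      = (γ.dropUntil v hv).reverse := fun h => takeUntil_append_of_isPath _ _ hp₂ h
  have e₄ : ∀ h, ((γ.dropUntil v hv).reverse.append (γ'.dropUntil v hv')).dropUntil v h
      = γ'.dropUntil v hv' := fun h => dropUntil_append_of_isPath _ _ hp₂ h
  refine ⟨?_, ?_, ?_, ?_, ?_, ?_, ?_⟩
  · refine isPath_append hp₁ (hγ'.takeUntil hv').reverse fun z hz hz' => hfirst z hz ?_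
    rw [support_reverse, List.mem_reverse] at hz'
    exact γ'.support_takeUntil_subset_support hv' hz'
  · refine isPath_append hp₂ (hγ'.dropUntil hv') fun z hz hz' => htail z ?_ hz'
    rwa [support_reverse, List.mem_reverse] at hz
  · intro h₁ h₂
    rw [e₁, e₃, reverse_reverse, take_spec]
  · intro h₁ h₂
    rw [e₂, e₄, reverse_reverse, take_spec]
  · intro h₁ z hz hz'
    rw [e₁] at hz
    rcases (mem_support_append_iff _ _).1 hz' with h' | h'
    · rw [support_reverse, List.mem_reverse] at h'
      exact eq_of_mem_takeUntil_dropUntil hγ hv hz h'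
    · exact hfirst z hz (γ'.support_dropUntil_subset_support hv' h')
  · intro h₁ h₂ z hz hz'
    rw [e₂, support_reverse, List.mem_reverse] at hz
    rw [e₄] at hz'
    exact eq_of_mem_takeUntil_dropUntil hγ' hv' hz hz'
  · have l₁ := congrArg Walk.length (γ.take_spec hv)
    have l₂ := congrArg Walk.length (γ'.take_spec hv')
    rw [length_append] at l₁ l₂
    simp only [length_append, length_reverse]
    omega

/-! ## Sums over pairs of paths -/

open Classical in
/-- The pairs of paths which meet and are not `bad` are parametrised faithfully by their
first-meeting data `(v, γ, γ')` (`v` the first vertex of `γ` on `γ'`, tails after `v` meeting only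
at `v`), so a sum over such pairs is a sum over first-meeting data. [folklore] -/
private theorem tsum_good_eq_tsum_first (H : SimpleGraph V) (f : ℕ → ℝ≥0∞)
    (bad : ∀ {a b c d : V}, H.Path a b → H.Path c d → Prop)
    (hbad : ∀ {a b c d : V} (γ : H.Path a b) (γ' : H.Path c d), bad γ γ' ↔
      ∃ (v : V) (hv : v ∈ γ.1.support) (hv' : v ∈ γ'.1.support),
        (∀ z ∈ (γ.1.takeUntil v hv).support, z ∈ γ'.1.support → z = v) ∧
        ∃ z, z ≠ v ∧ z ∈ (γ.1.dropUntil v hv).support ∧ z ∈ (γ'.1.dropUntil v hv').support)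
    (s t u v : V) :
    (∑' q : H.Path s t × H.Path u v,
        if ¬ List.Disjoint q.1.1.support q.2.1.support ∧ ¬ bad q.1 q.2
          then f (q.1.1.length + q.2.1.length) else 0) =
      ∑' m : {m : V × H.Path s t × H.Path u v // ∃ h₁ h₂,
          (∀ z ∈ (m.2.1.1.takeUntil m.1 h₁).support, z ∈ m.2.2.1.support → z = m.1) ∧
          ∀ z ∈ (m.2.1.1.dropUntil m.1 h₁).support, z ∈ (m.2.2.1.dropUntil m.1 h₂).support →
            z = m.1},
        f (m.1.2.1.1.length + m.1.2.2.1.length) := by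
  refine ((Function.Injective.tsum_eq
    (g := fun m : {m : V × H.Path s t × H.Path u v // ∃ h₁ h₂,
          (∀ z ∈ (m.2.1.1.takeUntil m.1 h₁).support, z ∈ m.2.2.1.support → z = m.1) ∧
          ∀ z ∈ (m.2.1.1.dropUntil m.1 h₁).support, z ∈ (m.2.2.1.dropUntil m.1 h₂).support →
            z = m.1} => m.1.2)
    (f := fun q : H.Path s t × H.Path u v =>
        if ¬ List.Disjoint q.1.1.support q.2.1.support ∧ ¬ bad q.1 q.2
          then f (q.1.1.length + q.2.1.length) else 0) ?_ ?_).symm.trans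
    (tsum_congr fun m => ?_))
  · -- injectivity: the first meeting vertex is determined by the pair
    rintro ⟨⟨v₁, q₁⟩, h₁⟩ ⟨⟨v₂, q₂⟩, h₂⟩ hq
    change q₁ = q₂ at hq
    subst hq
    obtain rfl : v₁ = v₂ :=
      first_unique h₁.fst h₂.fst h₁.snd.fst h₂.snd.fst h₁.snd.snd.1 h₂.snd.snd.1
    rfl
  · -- the support consists of good pairs, each of which has first-meeting data
    intro q hq
    rw [Function.mem_support] at hq
    by_cases hgood : ¬ List.Disjoint q.1.1.support q.2.1.support ∧ ¬ bad q.1 q.2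
    · obtain ⟨hnd, hnb⟩ := hgood
      obtain ⟨v₀, hv, hv', hfirst⟩ := first_exists q.1.1 q.2.1 hnd
      refine ⟨⟨(v₀, q), hv, hv', hfirst, fun z hz hz' => ?_⟩, rfl⟩
      by_contra hne
      exact hnb ((hbad q.1 q.2).2 ⟨v₀, hv, hv', hfirst, z, hne, hz, hz'⟩)
    · exact absurd (if_neg hgood) hq
  · -- on first-meeting data the pair is good
    obtain ⟨⟨v₀, q⟩, hv, hv', hfirst, htail⟩ := m
    refine if_pos ⟨fun hd => hd hv hv', fun hb => ?_⟩
    obtain ⟨v₂, hv₂, hv₂', hf₂, z, hne, hz, hz'⟩ := (hbad q.1 q.2).1 hb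
    obtain rfl : v₀ = v₂ := first_unique hv hv₂ hv' hv₂' hfirst hf₂
    exact hne (htail z hz hz')

open Classical in
/-- **Switching bijection.** The switch `(v, γ, γ') ↦ (v, γ[s,v]·γ'[u,v]⁻¹, γ[v,t]⁻¹·γ'[v,w])` is a
bijection (an involution up to relabelling) between first-meeting data of type `(s → t, u → w)`
and of type `(s → u, t → w)`, preserving the total length; hence the corresponding weighted sums
agree. [folklore] -/
private theorem tsum_first_switch (H : SimpleGraph V) (f : ℕ → ℝ≥0∞) (s t u v : V) :
    (∑' m : {m : V × H.Path s t × H.Path u v // ∃ h₁ h₂,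
          (∀ z ∈ (m.2.1.1.takeUntil m.1 h₁).support, z ∈ m.2.2.1.support → z = m.1) ∧
          ∀ z ∈ (m.2.1.1.dropUntil m.1 h₁).support, z ∈ (m.2.2.1.dropUntil m.1 h₂).support →
            z = m.1},
        f (m.1.2.1.1.length + m.1.2.2.1.length)) =
      ∑' m : {m : V × H.Path s u × H.Path t v // ∃ h₁ h₂,
          (∀ z ∈ (m.2.1.1.takeUntil m.1 h₁).support, z ∈ m.2.2.1.support → z = m.1) ∧
          ∀ z ∈ (m.2.1.1.dropUntil m.1 h₁).support, z ∈ (m.2.2.1.dropUntil m.1 h₂).support →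
            z = m.1},
        f (m.1.2.1.1.length + m.1.2.2.1.length) := by
  -- the switch, generic in the four endpoints
  let sw : ∀ {s t u v : V},
      {m : V × H.Path s t × H.Path u v // ∃ h₁ h₂,
          (∀ z ∈ (m.2.1.1.takeUntil m.1 h₁).support, z ∈ m.2.2.1.support → z = m.1) ∧
          ∀ z ∈ (m.2.1.1.dropUntil m.1 h₁).support, z ∈ (m.2.2.1.dropUntil m.1 h₂).support →
            z = m.1} →
      {m : V × H.Path s u × H.Path t v // ∃ h₁ h₂,
          (∀ z ∈ (m.2.1.1.takeUntil m.1 h₁).support, z ∈ m.2.2.1.support → z = m.1) ∧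
          ∀ z ∈ (m.2.1.1.dropUntil m.1 h₁).support, z ∈ (m.2.2.1.dropUntil m.1 h₂).support →
            z = m.1} :=
    fun {s t u v} m =>
      have hs := switch_spec (v := m.1.1) m.1.2.1.2 m.1.2.2.2 m.2.fst m.2.snd.fst m.2.snd.snd.1
        m.2.snd.snd.2
      ⟨(m.1.1, ⟨_, hs.1⟩, ⟨_, hs.2.1⟩),
        (mem_support_append_iff _ _).2 (Or.inl (end_mem_support _)),
        (mem_support_append_iff _ _).2 (Or.inl (end_mem_support _)),
        hs.2.2.2.2.1 _, hs.2.2.2.2.2.1 _ _⟩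
  -- the switch is an involution (up to relabelling of the endpoints)
  have hinv : ∀ {s t u v : V} (m : {m : V × H.Path s t × H.Path u v // ∃ h₁ h₂,
          (∀ z ∈ (m.2.1.1.takeUntil m.1 h₁).support, z ∈ m.2.2.1.support → z = m.1) ∧
          ∀ z ∈ (m.2.1.1.dropUntil m.1 h₁).support, z ∈ (m.2.2.1.dropUntil m.1 h₂).support →
            z = m.1}), sw (sw m) = m := by
    intro _ _ _ _ m
    have hs := switch_spec (v := m.1.1) m.1.2.1.2 m.1.2.2.2 m.2.fst m.2.snd.fst m.2.snd.snd.1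
      m.2.snd.snd.2
    refine Subtype.ext (Prod.ext rfl (Prod.ext (Subtype.ext ?_) (Subtype.ext ?_)))
    · exact hs.2.2.1 _ _
    · exact hs.2.2.2.1 _ _
  refine (tsum_congr fun m => ?_).trans
    (Equiv.tsum_eq ⟨sw, sw, fun m => hinv m, fun m => hinv m⟩ _)
  exact congrArg f (switch_spec (v := m.1.1) m.1.2.1.2 m.1.2.2.2 m.2.fst m.2.snd.fst
    m.2.snd.snd.1 m.2.snd.snd.2).2.2.2.2.2.2.symm

/-- A product of two path kernels is a sum over pairs of paths (`x ≥ 0`). [folklore] -/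
private theorem pathKernel_mul_eq_tsum (H : SimpleGraph V) (x : ℝ) (hx : 0 ≤ x) (a b c d : V) :
    pathKernel H x a b * pathKernel H x c d =
      ∑' q : H.Path a b × H.Path c d, ENNReal.ofReal (x ^ (q.1.1.length + q.2.1.length)) :=
  calc pathKernel H x a b * pathKernel H x c d
      = ∑' γ : H.Path a b, ENNReal.ofReal (x ^ γ.1.length) * pathKernel H x c d :=
        ENNReal.tsum_mul_right.symm
    _ = ∑' (γ : H.Path a b) (γ' : H.Path c d),
          ENNReal.ofReal (x ^ γ.1.length) * ENNReal.ofReal (x ^ γ'.1.length) :=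
        tsum_congr fun _ => ENNReal.tsum_mul_left.symm
    _ = ∑' q : H.Path a b × H.Path c d,
          ENNReal.ofReal (x ^ q.1.1.length) * ENNReal.ofReal (x ^ q.2.1.length) :=
        (ENNReal.tsum_prod (f := fun (γ : H.Path a b) (γ' : H.Path c d) =>
          ENNReal.ofReal (x ^ γ.1.length) * ENNReal.ofReal (x ^ γ'.1.length))).symm
    _ = ∑' q : H.Path a b × H.Path c d, ENNReal.ofReal (x ^ (q.1.1.length + q.2.1.length)) :=
        tsum_congr fun q => by rw [pow_add, ENNReal.ofReal_mul (pow_nonneg hx _)]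

/-- A restricted double sum over paths is a restricted sum over pairs (`x ≥ 0`). [folklore] -/
private theorem tsum₂_ite_eq (H : SimpleGraph V) (x : ℝ) (hx : 0 ≤ x) {a b c d : V}
    (P : H.Path a b → H.Path c d → Prop) [∀ γ γ', Decidable (P γ γ')] :
    (∑' (γ : H.Path a b) (γ' : H.Path c d),
        if P γ γ' then ENNReal.ofReal (x ^ γ.1.length) * ENNReal.ofReal (x ^ γ'.1.length) else 0) =
      ∑' q : H.Path a b × H.Path c d,
        if P q.1 q.2 then ENNReal.ofReal (x ^ (q.1.1.length + q.2.1.length)) else 0 := by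
  refine (ENNReal.tsum_prod (f := fun (γ : H.Path a b) (γ' : H.Path c d) =>
    if P γ γ' then ENNReal.ofReal (x ^ γ.1.length) * ENNReal.ofReal (x ^ γ'.1.length)
      else 0)).symm.trans (tsum_congr fun q => ?_)
  show (if P q.1 q.2 then _ else _) = _
  rw [pow_add, ENNReal.ofReal_mul (pow_nonneg hx _)]

/-! ## The switching identity -/

open Classical in
/-- The switching identity in the skeleton's `let` form (`w` = weights, `bad` as above). [folklore] -/
private theorem switchingIdentity_let (H : SimpleGraph V) (x : ℝ) (hx : 0 ≤ x) (p₁ p₂ p₃ p₄ : V)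
    (hI : Interlaced H p₁ p₂ p₃ p₄) :
    let w : {a b : V} → H.Path a b → ℝ≥0∞ := fun γ => ENNReal.ofReal (x ^ γ.1.length)
    let bad : {a b c d : V} → H.Path a b → H.Path c d → Prop := fun γ γ' =>
      ∃ (v : V) (hv : v ∈ γ.1.support) (hv' : v ∈ γ'.1.support),
        (∀ z ∈ (γ.1.takeUntil v hv).support, z ∈ γ'.1.support → z = v) ∧
        ∃ z, z ≠ v ∧ z ∈ (γ.1.dropUntil v hv).support ∧ z ∈ (γ'.1.dropUntil v hv').support
    pathKernel H x p₁ p₂ * pathKernel H x p₃ p₄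
        + (∑' (γ : H.Path p₁ p₃) (γ' : H.Path p₂ p₄), if bad γ γ' then w γ * w γ' else 0) =
      pathKernel H x p₁ p₃ * pathKernel H x p₂ p₄
        + (∑' (α : H.Path p₁ p₂) (β : H.Path p₃ p₄),
            if List.Disjoint α.1.support β.1.support then w α * w β else 0)
        + (∑' (α : H.Path p₁ p₂) (β : H.Path p₃ p₄), if bad α β then w α * w β else 0) := by
  intro w bad
  have hbad : ∀ {a b c d : V} (γ : H.Path a b) (γ' : H.Path c d), bad γ γ' ↔
      ∃ (v : V) (hv : v ∈ γ.1.support) (hv' : v ∈ γ'.1.support),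
        (∀ z ∈ (γ.1.takeUntil v hv).support, z ∈ γ'.1.support → z = v) ∧
        ∃ z, z ≠ v ∧ z ∈ (γ.1.dropUntil v hv).support ∧ z ∈ (γ'.1.dropUntil v hv').support :=
    fun _ _ => Iff.rfl
  simp only [w]
  rw [pathKernel_mul_eq_tsum H x hx p₁ p₂ p₃ p₄, pathKernel_mul_eq_tsum H x hx p₁ p₃ p₂ p₄,
    tsum₂_ite_eq H x hx (fun (γ : H.Path p₁ p₃) (γ' : H.Path p₂ p₄) => bad γ γ'),
    tsum₂_ite_eq H x hx (fun (α : H.Path p₁ p₂) (β : H.Path p₃ p₄) =>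
      List.Disjoint α.1.support β.1.support),
    tsum₂_ite_eq H x hx (fun (α : H.Path p₁ p₂) (β : H.Path p₃ p₄) => bad α β)]
  -- three-way split of the nested pairs: disjoint / meeting and good / bad
  have hN : (∑' q : H.Path p₁ p₂ × H.Path p₃ p₄,
        ENNReal.ofReal (x ^ (q.1.1.length + q.2.1.length))) =
      (∑' q : H.Path p₁ p₂ × H.Path p₃ p₄, if List.Disjoint q.1.1.support q.2.1.support
          then ENNReal.ofReal (x ^ (q.1.1.length + q.2.1.length)) else 0) +
      (∑' q : H.Path p₁ p₂ × H.Path p₃ p₄,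
          if ¬ List.Disjoint q.1.1.support q.2.1.support ∧ ¬ bad q.1 q.2
          then ENNReal.ofReal (x ^ (q.1.1.length + q.2.1.length)) else 0) +
      (∑' q : H.Path p₁ p₂ × H.Path p₃ p₄, if bad q.1 q.2
          then ENNReal.ofReal (x ^ (q.1.1.length + q.2.1.length)) else 0) := by
    rw [← ENNReal.tsum_add, ← ENNReal.tsum_add]
    refine tsum_congr fun q => ?_
    by_cases hd : List.Disjoint q.1.1.support q.2.1.support
    · have hb : ¬ bad q.1 q.2 := fun hb => by
        obtain ⟨v, hv, hv', -⟩ := (hbad q.1 q.2).1 hb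
        exact hd hv hv'
      simp [hd, hb]
    · by_cases hb : bad q.1 q.2 <;> simp [hd, hb]
  -- two-way split of the crossing pairs (they all meet, by interlacing): good / bad
  have hC : (∑' q : H.Path p₁ p₃ × H.Path p₂ p₄,
        ENNReal.ofReal (x ^ (q.1.1.length + q.2.1.length))) =
      (∑' q : H.Path p₁ p₃ × H.Path p₂ p₄,
          if ¬ List.Disjoint q.1.1.support q.2.1.support ∧ ¬ bad q.1 q.2
          then ENNReal.ofReal (x ^ (q.1.1.length + q.2.1.length)) else 0) +
      (∑' q : H.Path p₁ p₃ × H.Path p₂ p₄, if bad q.1 q.2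
          then ENNReal.ofReal (x ^ (q.1.1.length + q.2.1.length)) else 0) := by
    rw [← ENNReal.tsum_add]
    refine tsum_congr fun q => ?_
    have hd : ¬ List.Disjoint q.1.1.support q.2.1.support := fun hd => by
      obtain ⟨v, hv, hv'⟩ := hI q.1 q.2
      exact hd hv hv'
    by_cases hb : bad q.1 q.2 <;> simp [hd, hb]
  -- the good crossing pairs and the good meeting nested pairs have the same weight (switching)
  rw [hN, hC, tsum_good_eq_tsum_first H (fun n => ENNReal.ofReal (x ^ n)) @bad hbad p₁ p₃ p₂ p₄,
    tsum_good_eq_tsum_first H (fun n => ENNReal.ofReal (x ^ n)) @bad hbad p₁ p₂ p₃ p₄,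
    tsum_first_switch H (fun n => ENNReal.ofReal (x ^ n)) p₁ p₃ p₂ p₄]
  ring

open Classical in
/-- **First-meeting switching identity** (stub T5 of the line's skeleton, `let`-free form; `x ≥ 0`,
any simple graph). Switching a crossing pair `(γ : p₁ → p₃, γ' : p₂ → p₄)` at the FIRST vertex `v` of
`γ` on `γ'`, `(γ, γ') ↦ (γ[p₁,v]·γ'[p₂,v]⁻¹, γ[v,p₃]⁻¹·γ'[v,p₄])`, is a length-preserving bijection
from the crossing pairs whose tails after `v` are vertex-disjoint onto the meeting nested pairs whose
tails after the first meeting vertex are vertex-disjoint; under interlacing every crossing pair meets,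
hence `Z₁₂Z₃₄ + C_bad = Z₁₃Z₂₄ + D + N_bad` (`D` = disjoint nested pairs). [folklore] -/
theorem stub_switchingIdentity (H : SimpleGraph V) (x : ℝ) (hx : 0 ≤ x) (p₁ p₂ p₃ p₄ : V)
    (hI : Interlaced H p₁ p₂ p₃ p₄) :
    pathKernel H x p₁ p₂ * pathKernel H x p₃ p₄
        + (∑' (γ : H.Path p₁ p₃) (γ' : H.Path p₂ p₄),
            if (∃ (v : V) (hv : v ∈ γ.1.support) (hv' : v ∈ γ'.1.support),
                (∀ z ∈ (γ.1.takeUntil v hv).support, z ∈ γ'.1.support → z = v) ∧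
                ∃ z, z ≠ v ∧ z ∈ (γ.1.dropUntil v hv).support ∧ z ∈ (γ'.1.dropUntil v hv').support)
            then ENNReal.ofReal (x ^ γ.1.length) * ENNReal.ofReal (x ^ γ'.1.length) else 0) =
      pathKernel H x p₁ p₃ * pathKernel H x p₂ p₄
        + (∑' (α : H.Path p₁ p₂) (β : H.Path p₃ p₄),
            if List.Disjoint α.1.support β.1.support
            then ENNReal.ofReal (x ^ α.1.length) * ENNReal.ofReal (x ^ β.1.length) else 0)
        + (∑' (α : H.Path p₁ p₂) (β : H.Path p₃ p₄),
            if (∃ (v : V) (hv : v ∈ α.1.support) (hv' : v ∈ β.1.support),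
                (∀ z ∈ (α.1.takeUntil v hv).support, z ∈ β.1.support → z = v) ∧
                ∃ z, z ≠ v ∧ z ∈ (α.1.dropUntil v hv).support ∧ z ∈ (β.1.dropUntil v hv').support)
            then ENNReal.ofReal (x ^ α.1.length) * ENNReal.ofReal (x ^ β.1.length) else 0) :=
  switchingIdentity_let H x hx p₁ p₂ p₃ p₄ hI

end Summit.CriticalPhenomena.SAWScalingLimit.Theorems.BoundaryTP2
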